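import Mathlib
import Literature.NumberTheory.Transcendental.KZCalculusProofs
import Literature.NumberTheory.Transcendental.KZSemiCanonicalReductionProofs

/-!
# Stub `stub_ladderTransfer` (crux `OffTetraSectorKernel`, line `odd-hyperbolic-ladder`)

The "transfer" half of Goncharov's hyperbolic scissors ladder, read inside the Kontsevich–Zagier
calculus of moves. Rung `n` is the upper half-space `ℝⁿ × ℝ₊` of `ℍⁿ⁺¹` with coordinates
`p : Fin (n + 1) → ℝ`, height `t = p (Fin.last n)` and density `t^{-(n+1)}`.

For ANY class `D` of domains in `{t > 0}` and any admissible family `ρ` (for `P ∈ D`,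
`(ρ P).domain = P` and the integrand of `ρ P` is `t^{-(n+1)}` on `P`), ASSUMING the unit
inversion move and the boundary similarity move at this `n` (the first two hypotheses), every
element of the subgroup of `FreeAbelianGroup (Set (Fin (n + 1) → ℝ))` generated by the three
scissors relator sets

* a.e. dissections `[P] − [P₁] − [P₂]` (`P₁, P₂ ⊆ P` in `D`, `P₁ ∩ P₂` and `P \ (P₁ ∪ P₂)` null),
* inversion congruences `[ι P] − [P]` (`ι p = p / ∑ pₘ²`),
* similarity congruences `[g P] − [P]` (`g (x, t) = (c A x + b, c t)`, `c > 0`, `Aᵀ A = 1`,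
  all entries algebraic),

is sent into `KZ.relations` by the additive extension of `[P] ↦ [ρ P]`.

Pure bookkeeping: `AddSubgroup.closure_le` reduces the claim to generators; a dissection relator
is the tree's iterated rule (1a) modulo null sets `KZ.of_sub_sum_of_mem_relations` over `Fin 2`;
a congruence relator is the corresponding move hypothesis, reversed by symmetry of
`KZ.Equivalent`.
-/

noncomputable section

open Set MeasureTheory
open Literature.NumberTheory.Transcendental

namespace Summit.KontsevichZagierPeriods.HyperbolicBloch.OffTetraSectorKernel

/-- Rule (1a) modulo null sets for an a.e. dissection into two sub-domains: if `R₁.domain`,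
`R₂.domain ⊆ r.domain` meet in a null set, cover `r.domain` up to a null set, and carry the
integrand of `r`, then `[r] − [R₁] − [R₂] ∈ KZ.relations` (the tree's
`KZ.of_sub_sum_of_mem_relations`, specialised to the index set `Fin 2`).
[cite: KontsevichZagier2001, §1.2] -/
theorem ladderTransfer_of_sub_two_mem_relations {m : ℕ} (r R₁ R₂ : KZ.IntegralRep m)
    (hd₁ : R₁.domain ⊆ r.domain) (hd₂ : R₂.domain ⊆ r.domain)
    (hi₁ : EqOn R₁.integrand r.integrand R₁.domain)
    (hi₂ : EqOn R₂.integrand r.integrand R₂.domain)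
    (hnull : volume (R₁.domain ∩ R₂.domain) = 0)
    (hcov : volume (r.domain \ (R₁.domain ∪ R₂.domain)) = 0) :
    KZ.of r - KZ.of R₁ - KZ.of R₂ ∈ KZ.relations := by
  set R : Fin 2 → KZ.IntegralRep m := ![R₁, R₂] with hR
  have h := KZ.of_sub_sum_of_mem_relations (Finset.univ : Finset (Fin 2)) r R
    (fun i _ => by
      fin_cases i
      · simp [hR, sdiff_eq_empty.mpr hd₁]
      · simp [hR, sdiff_eq_empty.mpr hd₂])
    (fun i _ => by
      fin_cases i
      · simpa [hR] using hi₁.mono inter_subset_left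
      · simpa [hR] using hi₂.mono inter_subset_left)
    (by
      have : (⋃ i ∈ (Finset.univ : Finset (Fin 2)), (R i).domain) = R₁.domain ∪ R₂.domain := by
        ext p
        simp only [Finset.mem_univ, iUnion_true, mem_iUnion, mem_union, hR]
        constructor
        · rintro ⟨i, hi⟩
          fin_cases i
          · exact Or.inl (by simpa using hi)
          · exact Or.inr (by simpa using hi)
        · rintro (hi | hi)
          · exact ⟨0, by simpa using hi⟩
          · exact ⟨1, by simpa using hi⟩
      rw [this]; exact hcov)
    (by
      intro i _ j _ hij
      fin_cases i <;> fin_cases j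
      · exact absurd rfl hij
      · simpa [hR] using hnull
      · simpa [hR, inter_comm] using hnull
      · exact absurd rfl hij)
  have hsum : ∑ i ∈ (Finset.univ : Finset (Fin 2)), KZ.of (R i) = KZ.of R₁ + KZ.of R₂ := by
    rw [Fin.sum_univ_two]; simp [hR]
  rw [hsum] at h
  have e : KZ.of r - KZ.of R₁ - KZ.of R₂ = KZ.of r - (KZ.of R₁ + KZ.of R₂) := by abel
  rw [e]; exact h

/-- **Transfer along the hyperbolic scissors ladder.** For any class `D` of domains in the upper
half-space and any admissible family `ρ` (domain `P`, integrand `t^{-(n+1)}`), assuming the unit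
inversion move and the boundary similarity move in dimension `n + 1`, the additive map
`[P] ↦ [ρ P]` sends the subgroup generated by the scissors relators over `D` (a.e. dissections,
inversion congruences, similarity congruences) into `KZ.relations`: scissors-congruence relations
among the domains of `D` are Kontsevich–Zagier relations among the integrals `∫_P t^{-(n+1)}`.
[cite: KontsevichZagier2001, §1.2] -/
theorem stub_ladderTransfer : ∀ (n : ℕ) (D : Set (Set (Fin (n + 1) → ℝ))) (ρ : Set (Fin (n + 1) → ℝ) → Literature.NumberTheory.Transcendental.KZ.IntegralRep (n + 1)), (∀ (r r' : Literature.NumberTheory.Transcendental.KZ.IntegralRep (n + 1)), r.domain ⊆ {p : Fin (n + 1) → ℝ | 0 < p (Fin.last n)} → Set.EqOn r.integrand (fun p : Fin (n + 1) → ℝ => 1 / p (Fin.last n) ^ (n + 1)) r.domain → r'.domain = (fun p : Fin (n + 1) → ℝ => fun l => p l / ∑ m, p m ^ 2) '' r.domain → Set.EqOn r'.integrand (fun p : Fin (n + 1) → ℝ => 1 / p (Fin.last n) ^ (n + 1)) r'.domain → Literature.NumberTheory.Transcendental.KZ.Equivalent r r') → (∀ (c : ℝ) (A : Matrix (Fin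 n) (Fin n) ℝ) (b : Fin n → ℝ), IsAlgebraic ℚ c → 0 < c → (∀ i j, IsAlgebraic ℚ (A i j)) → A.transpose * A = 1 → (∀ i, IsAlgebraic ℚ (b i)) → ∀ (r r' : Literature.NumberTheory.Transcendental.KZ.IntegralRep (n + 1)), r.domain ⊆ {p : Fin (n + 1) → ℝ | 0 < p (Fin.last n)} → Set.EqOn r.integrand (fun p : Fin (n + 1) → ℝ => 1 / p (Fin.last n) ^ (n + 1)) r.domain → r'.domain = (fun p : Fin (n + 1) → ℝ => (Fin.snoc (α := fun _ => ℝ) (c • A.mulVec (Fin.init p) + b) (c * p (Fin.last n)) : Fin (n + 1) → ℝ)) '' r.domain → Set.EqOn r'.integrand (fun p : Fin (n + 1) → ℝ => 1 / p (Fin.last n) ^ (n + 1)) r'.domain → Literature.NumberTheory.Transcendental.KZ.Equivalent r r') → (∀ P ∈ D, P ⊆ {p : Fin (n + 1) → ℝ | 0 < p (Fin.last n)}) → (∀ P ∈ D, (ρ P).domain = P ∧ Set.EqOn (ρ P).integrand (fun p : Fin (n + 1) → ℝ => 1 / p (Fin.last n) ^ (n + 1)) P) → ∀ x ∈ AddSubgroup.closure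 ({x : FreeAbelianGroup (Set (Fin (n + 1) → ℝ)) | ∃ P P₁ P₂ : Set (Fin (n + 1) → ℝ), P ∈ D ∧ P₁ ∈ D ∧ P₂ ∈ D ∧ P₁ ⊆ P ∧ P₂ ⊆ P ∧ MeasureTheory.volume (P₁ ∩ P₂) = 0 ∧ MeasureTheory.volume (P \ (P₁ ∪ P₂)) = 0 ∧ x = FreeAbelianGroup.of P - FreeAbelianGroup.of P₁ - FreeAbelianGroup.of P₂} ∪ {x : FreeAbelianGroup (Set (Fin (n + 1) → ℝ)) | ∃ P P' : Set (Fin (n + 1) → ℝ), P ∈ D ∧ P' ∈ D ∧ P' = (fun p : Fin (n + 1) → ℝ => fun l => p l / ∑ m, p m ^ 2) '' P ∧ x = FreeAbelianGroup.of P' - FreeAbelianGroup.of P} ∪ {x : FreeAbelianGroup (Set (Fin (n + 1) → ℝ)) | ∃ (P P' : Set (Fin (n + 1) → ℝ)) (c : ℝ) (A : Matrix (Fin n) (Fin n) ℝ) (b : Fin n → ℝ), P ∈ D ∧ P' ∈ D ∧ IsAlgebraic ℚ c ∧ 0 < c ∧ (∀ i j, IsAlgebraic ℚ (A i j)) ∧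 A.transpose * A = 1 ∧ (∀ i, IsAlgebraic ℚ (b i)) ∧ P' = (fun p : Fin (n + 1) → ℝ => (Fin.snoc (α := fun _ => ℝ) (c • A.mulVec (Fin.init p) + b) (c * p (Fin.last n)) : Fin (n + 1) → ℝ)) '' P ∧ x = FreeAbelianGroup.of P' - FreeAbelianGroup.of P}), FreeAbelianGroup.lift (fun P : Set (Fin (n + 1) → ℝ) => Literature.NumberTheory.Transcendental.KZ.of (ρ P)) x ∈ Literature.NumberTheory.Transcendental.KZ.relations := by
  intro n D ρ hInv hSim hU hρ x hx
  refine (AddSubgroup.closure_le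
    (K := KZ.relations.comap
      (FreeAbelianGroup.lift fun P : Set (Fin (n + 1) → ℝ) => KZ.of (ρ P)))).mpr ?_ hx
  rintro y ((⟨P, P₁, P₂, hP, hP₁, hP₂, h₁, h₂, hnull, hcov, rfl⟩ | ⟨P, P', hP, hP', hPP', rfl⟩) |
    ⟨P, P', c, A, b, hP, hP', hc, hcpos, hA, hAA, hb, hPP', rfl⟩)
  · -- (i) an a.e. dissection `[P] − [P₁] − [P₂]`: iterated rule (1a) modulo null sets
    simp only [SetLike.mem_coe, AddSubgroup.mem_comap, map_sub, FreeAbelianGroup.lift_apply_of]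
    obtain ⟨hdP, hiP⟩ := hρ P hP
    obtain ⟨hdP₁, hiP₁⟩ := hρ P₁ hP₁
    obtain ⟨hdP₂, hiP₂⟩ := hρ P₂ hP₂
    refine ladderTransfer_of_sub_two_mem_relations (ρ P) (ρ P₁) (ρ P₂) ?_ ?_ ?_ ?_ ?_ ?_
    · rw [hdP, hdP₁]; exact h₁
    · rw [hdP, hdP₂]; exact h₂
    · rw [hdP₁]; exact fun p hp => (hiP₁ hp).trans (hiP (h₁ hp)).symm
    · rw [hdP₂]; exact fun p hp => (hiP₂ hp).trans (hiP (h₂ hp)).symm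
    · rw [hdP₁, hdP₂]; exact hnull
    · rw [hdP, hdP₁, hdP₂]; exact hcov
  · -- (ii) an inversion congruence `[ι P] − [P]`: the unit inversion move, reversed
    simp only [SetLike.mem_coe, AddSubgroup.mem_comap, map_sub, FreeAbelianGroup.lift_apply_of]
    obtain ⟨hdP, hiP⟩ := hρ P hP
    obtain ⟨hdP', hiP'⟩ := hρ P' hP'
    have hE : KZ.Equivalent (ρ P) (ρ P') :=
      hInv (ρ P) (ρ P') (by rw [hdP]; exact hU P hP) (by rw [hdP]; exact hiP)
        (by rw [hdP', hdP]; exact hPP') (by rw [hdP']; exact hiP')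
    exact hE.symm
  · -- (iii) a similarity congruence `[g P] − [P]`: the boundary similarity move, reversed
    simp only [SetLike.mem_coe, AddSubgroup.mem_comap, map_sub, FreeAbelianGroup.lift_apply_of]
    obtain ⟨hdP, hiP⟩ := hρ P hP
    obtain ⟨hdP', hiP'⟩ := hρ P' hP'
    have hE : KZ.Equivalent (ρ P) (ρ P') :=
      hSim c A b hc hcpos hA hAA hb (ρ P) (ρ P') (by rw [hdP]; exact hU P hP)
        (by rw [hdP]; exact hiP) (by rw [hdP', hdP]; exact hPP') (by rw [hdP']; exact hiP')
    exact hE.symm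

end Summit.KontsevichZagierPeriods.HyperbolicBloch.OffTetraSectorKernel
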